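import Summits.ResolutionOfSingularities.ResolutionOfSingularities.Theorems.FrobeniusLadderFInjectiveMacaulayficationPencilChartPackage
import HarnessLib

/-!
# BED Ω, GLOBAL PATCH (g-b), F6 GLUE: on a toric chart of `Bl_A X`, ANY monomial ideal whose order is attained at a member is PRINCIPAL — `(x^e : e ∈ B)·Γ(D₊(x^m t)) = (Φ⁻¹ ȳ^{V b})`
# for `b ∈ B` with `V b ≤ V e` (`e ∈ B`); with `B = A_L`, `b = m_L(parent)` (✓ `SubconeOrder.hge_of_subcone`) this is the invertibility of `L·𝒪` on the charts of the refined class model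
# `X̃₂ = Bl_{K″} X` required by ✓ `OmegaCureCentreFactors.exists_cure_fac_of_isEffectiveCartier` (`g14/F6-ARCHITECTURE.md` (0))
# (crux `FInjectiveMacaulayfication` stmt-ResolutionOfSingularities-15315, chain w45a; seat res-L1-w45a-stub-3 g14)

[OURS · L1 W4.5a] Support file (`--supports stmt-ResolutionOfSingularities-15315 --as helper`); theorems only; GENERIC (any field, any `f`, any chart datum); no named fact; NOT a statement of
any manuscript; nothing of the crux is proved. AI-written (AI review is weaker than expert review).
* `span_monomials_eq_map` — `(x̄^e : e ∈ B) = (x^e : e ∈ B)·(k[x]/(f))`; ★ `ideal_comap_span_monomials_chart` — the chart formula above (✓ `MonomialChartSections.ideal_comap_chartOpen_eq_comap` +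
  ✓ `PencilChartPackage.map_theta_span_monomials`); ★ `exists_generator_of_chart` — hence `∃ γ ∈ Γ(D₊(x^m t))` regular with `(x^e : e ∈ B)~·𝒪 (D₊(x^m t)) = (γ)` when `θ` is prime and
  free of variables (the `IsEffectiveCartier` witness at every point of that chart).
[cite: CoxLittleSchenck2011, §3.1 and Thm. 3.1.19; StacksProject, Tag 0804]
-/

set_option linter.dupNamespace false

noncomputable section

open AlgebraicGeometry CategoryTheory Literature.AlgebraicGeometry.Resolution MvPolynomial

namespace Summit.ResolutionOfSingularities.ResolutionOfSingularities.Theorems.FInjectiveMacaulayfication.ChartPrincipalIdeal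

open Summit.ResolutionOfSingularities.ResolutionOfSingularities.Theorems.FInjectiveMacaulayfication

variable {n : ℕ} {k : Type} [Field k]

/-- `(x̄^e : e ∈ B) = (x^e : e ∈ B)·(k[x]/(f))`. [plumbing] -/
theorem span_monomials_eq_map (f : MvPolynomial (Fin n) k) (B : Finset (Fin n →₀ ℕ)) :
    Ideal.span ((fun e : Fin n →₀ ℕ => Ideal.Quotient.mk (Ideal.span {f}) (monomial e (1 : k))) '' (B : Set (Fin n →₀ ℕ))) =
      (Ideal.span ((fun e : Fin n →₀ ℕ => (monomial e (1 : k) : MvPolynomial (Fin n) k)) '' (B : Set (Fin n →₀ ℕ)))).map (Ideal.Quotient.mk (Ideal.span {f})) := by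
  rw [Ideal.map_span, ← Set.image_comp]
  rfl

variable (f : MvPolynomial (Fin n) k) (V : Matrix (Fin n) (Fin n) ℕ) (m : Fin n →₀ ℕ) (A : Finset (Fin n →₀ ℕ)) (θ : MvPolynomial (Fin n) k)
  (hm : Ideal.Quotient.mk (Ideal.span {f}) (monomial m (1 : k)) ∈
    Ideal.span ((fun e : Fin n →₀ ℕ => Ideal.Quotient.mk (Ideal.span {f}) (monomial e (1 : k))) '' (A : Set (Fin n →₀ ℕ))))

set_option maxHeartbeats 400000 in
/-- ★ **A MONOMIAL IDEAL WHOSE ORDER IS ATTAINED AT A MEMBER IS PRINCIPAL ON THE CHART**: for `b ∈ B` with `V b ≤ V e` for all `e ∈ B`,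
`(x^e : e ∈ B)~·𝒪(D₊(x^m t)) = (Φ⁻¹ ȳ^{V b})`. [OURS · F6 glue; cite: CoxLittleSchenck2011, §3.1] -/
theorem ideal_comap_span_monomials_chart
    (Φ : Γ(affineBlowup (Ideal.span ((fun e : Fin n →₀ ℕ => Ideal.Quotient.mk (Ideal.span {f}) (monomial e (1 : k))) '' (A : Set (Fin n →₀ ℕ)))),
        affineBlowup.chartOpen (Ideal.Quotient.mk (Ideal.span {f}) (monomial m (1 : k))) hm) ≃+* (MvPolynomial (Fin n) k ⧸ Ideal.span {θ}))
    (hΦ : ∀ q : MvPolynomial (Fin n) k,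
        Φ (affineBlowup.pull (Ideal.span ((fun e : Fin n →₀ ℕ => Ideal.Quotient.mk (Ideal.span {f}) (monomial e (1 : k))) '' (A : Set (Fin n →₀ ℕ))))
            (affineBlowup.chartOpen (Ideal.Quotient.mk (Ideal.span {f}) (monomial m (1 : k))) hm) (Ideal.Quotient.mk (Ideal.span {f}) q)) =
          Ideal.Quotient.mk (Ideal.span {θ}) (aeval (fun j : Fin n => ∏ i : Fin n, (X i : MvPolynomial (Fin n) k) ^ V i j) q))
    (B : Finset (Fin n →₀ ℕ)) (b : Fin n →₀ ℕ) (hbB : b ∈ B)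
    (hgeB : ∀ e ∈ B, (Finsupp.equivFunOnFinite.symm (V.mulVec ⇑b) : Fin n →₀ ℕ) ≤ Finsupp.equivFunOnFinite.symm (V.mulVec ⇑e)) :
    ((affineBlowup.idealSheaf (Ideal.span ((fun e : Fin n →₀ ℕ => Ideal.Quotient.mk (Ideal.span {f}) (monomial e (1 : k))) '' (B : Set (Fin n →₀ ℕ))))).comap
        (affineBlowup.π (Ideal.span ((fun e : Fin n →₀ ℕ => Ideal.Quotient.mk (Ideal.span {f}) (monomial e (1 : k))) '' (A : Set (Fin n →₀ ℕ)))))).ideal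
        (affineBlowup.chartOpen (Ideal.Quotient.mk (Ideal.span {f}) (monomial m (1 : k))) hm) =
      Ideal.span {Φ.symm (Ideal.Quotient.mk (Ideal.span {θ}) (monomial (Finsupp.equivFunOnFinite.symm (V.mulVec ⇑b)) (1 : k)))} := by
  have h1 := MonomialChartSections.ideal_comap_chartOpen_eq_comap f V m A θ hm Φ hΦ
    (Ideal.span ((fun e : Fin n →₀ ℕ => (monomial e (1 : k) : MvPolynomial (Fin n) k)) '' (B : Set (Fin n →₀ ℕ))))
  rw [← span_monomials_eq_map f B] at h1
  rw [h1, PencilChartPackage.map_theta_span_monomials V b B hbB hgeB θ, RingEquiv.toRingHom_eq_coe, Ideal.comap_coe, ← Ideal.map_symm, Ideal.map_span, Set.image_singleton]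

/-- ★ **THE EFFECTIVE-CARTIER WITNESS ON THE CHART**: under the same hypotheses, with `θ` prime and free of variables, `(x^e : e ∈ B)~·𝒪(D₊(x^m t)) = (γ)` for a non-zero-divisor `γ`.
[OURS · F6 glue] -/
theorem exists_generator_of_chart (hθp : Prime θ) (hcop : ∀ i : Fin n, ¬ (X i ∣ θ))
    (Φ : Γ(affineBlowup (Ideal.span ((fun e : Fin n →₀ ℕ => Ideal.Quotient.mk (Ideal.span {f}) (monomial e (1 : k))) '' (A : Set (Fin n →₀ ℕ)))),
        affineBlowup.chartOpen (Ideal.Quotient.mk (Ideal.span {f}) (monomial m (1 : k))) hm) ≃+* (MvPolynomial (Fin n) k ⧸ Ideal.span {θ}))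
    (hΦ : ∀ q : MvPolynomial (Fin n) k,
        Φ (affineBlowup.pull (Ideal.span ((fun e : Fin n →₀ ℕ => Ideal.Quotient.mk (Ideal.span {f}) (monomial e (1 : k))) '' (A : Set (Fin n →₀ ℕ))))
            (affineBlowup.chartOpen (Ideal.Quotient.mk (Ideal.span {f}) (monomial m (1 : k))) hm) (Ideal.Quotient.mk (Ideal.span {f}) q)) =
          Ideal.Quotient.mk (Ideal.span {θ}) (aeval (fun j : Fin n => ∏ i : Fin n, (X i : MvPolynomial (Fin n) k) ^ V i j) q))
    (B : Finset (Fin n →₀ ℕ)) (b : Fin n →₀ ℕ) (hbB : b ∈ B)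
    (hgeB : ∀ e ∈ B, (Finsupp.equivFunOnFinite.symm (V.mulVec ⇑b) : Fin n →₀ ℕ) ≤ Finsupp.equivFunOnFinite.symm (V.mulVec ⇑e)) :
    ∃ γ ∈ nonZeroDivisors Γ(affineBlowup (Ideal.span ((fun e : Fin n →₀ ℕ => Ideal.Quotient.mk (Ideal.span {f}) (monomial e (1 : k))) '' (A : Set (Fin n →₀ ℕ)))),
        affineBlowup.chartOpen (Ideal.Quotient.mk (Ideal.span {f}) (monomial m (1 : k))) hm),
      ((affineBlowup.idealSheaf (Ideal.span ((fun e : Fin n →₀ ℕ => Ideal.Quotient.mk (Ideal.span {f}) (monomial e (1 : k))) '' (B : Set (Fin n →₀ ℕ))))).comap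
          (affineBlowup.π (Ideal.span ((fun e : Fin n →₀ ℕ => Ideal.Quotient.mk (Ideal.span {f}) (monomial e (1 : k))) '' (A : Set (Fin n →₀ ℕ)))))).ideal
          (affineBlowup.chartOpen (Ideal.Quotient.mk (Ideal.span {f}) (monomial m (1 : k))) hm) = Ideal.span {γ} := by
  refine ⟨Φ.symm (Ideal.Quotient.mk (Ideal.span {θ}) (monomial (Finsupp.equivFunOnFinite.symm (V.mulVec ⇑b)) (1 : k))), ?_,
    ideal_comap_span_monomials_chart f V m A θ hm Φ hΦ B b hbB hgeB⟩
  haveI : (Ideal.span {θ}).IsPrime := (Ideal.span_singleton_prime hθp.ne_zero).mpr hθp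
  haveI : IsDomain (MvPolynomial (Fin n) k ⧸ Ideal.span {θ}) := Ideal.Quotient.isDomain _
  exact (PencilBlowupLocalCharts.regularPair_of_ringEquiv Φ.symm
    (PencilQuotFinSucc.mk_mem_nonZeroDivisors hθp (PencilQuotFinSucc.not_dvd_monomial_of_forall_not_X_dvd hθp hcop _)) (v := 1) (fun r h => by simpa using h)).1

/-! ## Variant without primality of `θ`: integrality of the chart ring + `θ(0) ≠ 0`, `θ` not a unit -/

/-- A polynomial with non-zero constant coefficient which is not a unit divides no monomial. [folklore; Mathlib `dvd_monomial_mul_iff_exists`] -/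
theorem not_dvd_monomial_of_constantCoeff_ne_zero {θ : MvPolynomial (Fin n) k} (h0 : constantCoeff θ ≠ 0) (hu : ¬ IsUnit θ) (e : Fin n →₀ ℕ) :
    ¬ θ ∣ monomial e (1 : k) := by
  intro h
  have h' : θ ∣ monomial e (1 : k) * 1 := by simpa using h
  obtain ⟨m, r, -, hr1, hθ⟩ := MvPolynomial.dvd_monomial_mul_iff_exists.mp h'
  have hru : IsUnit r := isUnit_of_dvd_one hr1
  by_cases hm : m = 0
  · subst hm
    apply hu
    rw [hθ, monomial_zero', C_1, one_mul]
    exact hru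
  · apply h0
    rw [hθ, map_mul, constantCoeff_monomial, if_neg hm, zero_mul]

/-- ★ **THE GENERATOR WITHOUT PRIMALITY OF `θ`**: if the chart ring `Γ(D₊(x^m t))` is a domain (e.g. `Bl_A X` integral), `θ(0) ≠ 0` and `θ` is not a unit, then `(x^e : e ∈ B)~·𝒪(D₊(x^m t)) = (γ)`
with `γ` a non-zero-divisor — the form usable on all 1223 charts of `X̃₂` (no `Prime θ_σ`). [OURS · F6 glue] -/
theorem exists_generator_of_chart' (h0 : constantCoeff θ ≠ 0) (hu : ¬ IsUnit θ)
    [IsDomain Γ(affineBlowup (Ideal.span ((fun e : Fin n →₀ ℕ => Ideal.Quotient.mk (Ideal.span {f}) (monomial e (1 : k))) '' (A : Set (Fin n →₀ ℕ)))),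
        affineBlowup.chartOpen (Ideal.Quotient.mk (Ideal.span {f}) (monomial m (1 : k))) hm)]
    (Φ : Γ(affineBlowup (Ideal.span ((fun e : Fin n →₀ ℕ => Ideal.Quotient.mk (Ideal.span {f}) (monomial e (1 : k))) '' (A : Set (Fin n →₀ ℕ)))),
        affineBlowup.chartOpen (Ideal.Quotient.mk (Ideal.span {f}) (monomial m (1 : k))) hm) ≃+* (MvPolynomial (Fin n) k ⧸ Ideal.span {θ}))
    (hΦ : ∀ q : MvPolynomial (Fin n) k,
        Φ (affineBlowup.pull (Ideal.span ((fun e : Fin n →₀ ℕ => Ideal.Quotient.mk (Ideal.span {f}) (monomial e (1 : k))) '' (A : Set (Fin n →₀ ℕ))))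
            (affineBlowup.chartOpen (Ideal.Quotient.mk (Ideal.span {f}) (monomial m (1 : k))) hm) (Ideal.Quotient.mk (Ideal.span {f}) q)) =
          Ideal.Quotient.mk (Ideal.span {θ}) (aeval (fun j : Fin n => ∏ i : Fin n, (X i : MvPolynomial (Fin n) k) ^ V i j) q))
    (B : Finset (Fin n →₀ ℕ)) (b : Fin n →₀ ℕ) (hbB : b ∈ B)
    (hgeB : ∀ e ∈ B, (Finsupp.equivFunOnFinite.symm (V.mulVec ⇑b) : Fin n →₀ ℕ) ≤ Finsupp.equivFunOnFinite.symm (V.mulVec ⇑e)) :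
    ∃ γ ∈ nonZeroDivisors Γ(affineBlowup (Ideal.span ((fun e : Fin n →₀ ℕ => Ideal.Quotient.mk (Ideal.span {f}) (monomial e (1 : k))) '' (A : Set (Fin n →₀ ℕ)))),
        affineBlowup.chartOpen (Ideal.Quotient.mk (Ideal.span {f}) (monomial m (1 : k))) hm),
      ((affineBlowup.idealSheaf (Ideal.span ((fun e : Fin n →₀ ℕ => Ideal.Quotient.mk (Ideal.span {f}) (monomial e (1 : k))) '' (B : Set (Fin n →₀ ℕ))))).comap
          (affineBlowup.π (Ideal.span ((fun e : Fin n →₀ ℕ => Ideal.Quotient.mk (Ideal.span {f}) (monomial e (1 : k))) '' (A : Set (Fin n →₀ ℕ)))))).ideal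
          (affineBlowup.chartOpen (Ideal.Quotient.mk (Ideal.span {f}) (monomial m (1 : k))) hm) = Ideal.span {γ} := by
  refine ⟨Φ.symm (Ideal.Quotient.mk (Ideal.span {θ}) (monomial (Finsupp.equivFunOnFinite.symm (V.mulVec ⇑b)) (1 : k))), ?_,
    ideal_comap_span_monomials_chart f V m A θ hm Φ hΦ B b hbB hgeB⟩
  apply mem_nonZeroDivisors_of_ne_zero
  intro hz
  have h1 : Ideal.Quotient.mk (Ideal.span {θ}) (monomial (Finsupp.equivFunOnFinite.symm (V.mulVec ⇑b)) (1 : k)) = 0 := by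
    rw [← Φ.apply_symm_apply (Ideal.Quotient.mk _ _), hz, map_zero]
  rw [Ideal.Quotient.eq_zero_iff_mem, Ideal.mem_span_singleton] at h1
  exact not_dvd_monomial_of_constantCoeff_ne_zero h0 hu _ h1

end Summit.ResolutionOfSingularities.ResolutionOfSingularities.Theorems.FInjectiveMacaulayfication.ChartPrincipalIdeal

end
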